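import Mathlib
import Summits.Ventures.PercRepro2.Defs
import Summits.Ventures.PercRepro2.Graph
import Summits.Ventures.PercRepro2.MM0Sector
import Summits.Ventures.PercRepro2.MM0Pinned

/-!
# The s-cluster exchange: an involution of every three-copy fibre of (MM0⁻)
(blind cell PercRepro2, night-1 g3; `proofs/NIGHT1-INJ.md` §2)

For two configurations `x, y` and a vertex set `U`, `mix x y U` takes `y` on the edges touching `U`
and `x` elsewhere.  If `U ⊇ C_y(s)` then `C_{mix x y U}(s) = C_y(s)` (`cluster_mix_eq`: the domain
Markov property `cluster_eq_of_eqOn_touches`).  The **s-exchange** of a triple `(x, y, z)` is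
`σ(x, y, z) = (mix x y U, mix y x U, z)` with `U = C_x(s) ∪ C_y(s)`: it swaps the `x`- and `y`-status of
every edge touching `U` and leaves `z` alone.  Theorems:

* `orderStats_sExchange`: `σ` preserves the order statistics `(lo, med, hi)` — it maps every fibre to itself;
* `cluster_sExchange_fst` / `cluster_sExchange_snd`: `C_{x'}(s) = C_y(s)` and `C_{y'}(s) = C_x(s)` — the
  s-clusters are EXCHANGED exactly (so `y(x') = y(y)`, `y(y') = y(x)`, `x' ∈ R ↔ y ∈ R`, `y' ∈ R ↔ x ∈ R`);
* `sExchange_sExchange`: `σ` is an involution;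
* `conn_sExchange_fst_iff` / `conn_sExchange_snd_iff`: the root connection events are exchanged.

Consequences (paper, NIGHT1-INJ.md §2): `K(x,y,z) + K(σ(x,y,z)) = 1_R(y) 1_R(z) (1_Y(x) − 1_Y(y)) (g(x) − g(x'))`
with `g(x) = 1_gate(x) (1_Zev(x) − 1_Z₀(z))`, so `2 c(pat) = ∑_{fibre} 1_R(y) 1_R(z) (1_Y(x) − 1_Y(y)) (g(x) − g(x'))`:
the pinned statement of row 2′MM0 says that, summed over a fibre, the t-side functional `g` of the
`x`-copy does not grow on average when `x`'s s-cluster is replaced by `y`'s (weighted by which of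
the two clusters carries `b`).  When `C_y(s)` avoids `K⁺_x` and no `y`-open edge joins
`C_x(s) ∖ C_y(s)` to `K⁺_x`, the t-side of `x` is untouched and the summand is `0` (census: 0
exceptions / 240 such triples, `sigy_stats.py`); the content of `PinnedMM0` sits in the OVERLAPPING
triples (`C_y(s) ∩ K⁺_x ≠ ∅`), where every exchange rule tried so far fails to be injective
(NIGHT1-INJ.md §3).  Standard axioms, Mathlib + cell prefix only.
-/

namespace Summit.Ventures.PercRepro2
namespace MM0Pinned

open MM0Sector

variable {V : Type*} {E : Type*}

/-! ## Mixing two configurations along the edges touching a vertex set -/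

section Mix

variable (ends : E → Sym2 V)

open Classical in
/-- `mix x y U`: `y` on the edges touching `U`, `x` elsewhere. -/
noncomputable def mix (x y : Config E) (U : Set V) : Config E :=
  fun e => if e ∈ touches ends U then y e else x e

variable {ends}

open Classical in
/-- On an edge touching `U`, `mix x y U` is `y`. -/
lemma mix_apply_of_mem {x y : Config E} {U : Set V} {e : E} (h : e ∈ touches ends U) :
    mix ends x y U e = y e := by
  unfold mix; rw [if_pos h]

open Classical in
/-- On an edge not touching `U`, `mix x y U` is `x`. -/
lemma mix_apply_of_notMem {x y : Config E} {U : Set V} {e : E} (h : e ∉ touches ends U) :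
    mix ends x y U e = x e := by
  unfold mix; rw [if_neg h]

/-- Mixing twice with the same set restores the configuration. -/
lemma mix_mix (x y : Config E) (U : Set V) : mix ends (mix ends x y U) (mix ends y x U) U = x := by
  funext e
  by_cases h : e ∈ touches ends U
  · rw [mix_apply_of_mem h, mix_apply_of_mem h]
  · rw [mix_apply_of_notMem h, mix_apply_of_notMem h]

/-- **The cluster of `s` after mixing**: if `U ⊇ C_y(s)` then `C_{mix x y U}(s) = C_y(s)` (domain
Markov property: the mix agrees with `y` on every edge touching `C_y(s)`). -/
theorem cluster_mix_eq (x y : Config E) {U : Set V} {s : V} (hU : cluster ends y s ⊆ U) :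
    cluster ends (mix ends x y U) s = cluster ends y s := by
  refine cluster_eq_of_eqOn_touches (ω := y) (fun e he => ?_) rfl
  obtain ⟨a, ha, c, hac⟩ := he
  exact (mix_apply_of_mem (mem_touches_of_ends hac (Or.inl (hU ha)))).symm

end Mix

/-! ## The s-exchange of a triple -/

section SExchange

variable (ends : E → Sym2 V) (s : V)

/-- The s-exchange: swap the `x`- and `y`-status of every edge touching `C_x(s) ∪ C_y(s)`. -/
noncomputable def sExchange (xyz : Config E × Config E × Config E) :
    Config E × Config E × Config E :=
  (mix ends xyz.1 xyz.2.1 (cluster ends xyz.1 s ∪ cluster ends xyz.2.1 s),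
    mix ends xyz.2.1 xyz.1 (cluster ends xyz.1 s ∪ cluster ends xyz.2.1 s), xyz.2.2)

variable {ends s}

/-- `C_{x'}(s) = C_y(s)`. -/
theorem cluster_sExchange_fst (xyz : Config E × Config E × Config E) :
    cluster ends (sExchange ends s xyz).1 s = cluster ends xyz.2.1 s :=
  cluster_mix_eq _ _ Set.subset_union_right

/-- `C_{y'}(s) = C_x(s)`. -/
theorem cluster_sExchange_snd (xyz : Config E × Config E × Config E) :
    cluster ends (sExchange ends s xyz).2.1 s = cluster ends xyz.1 s :=
  cluster_mix_eq _ _ Set.subset_union_left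

/-- The `z`-copy is untouched. -/
@[simp] lemma sExchange_third (xyz : Config E × Config E × Config E) :
    (sExchange ends s xyz).2.2 = xyz.2.2 := rfl

/-- **The s-exchange is an involution.** -/
theorem sExchange_sExchange (xyz : Config E × Config E × Config E) :
    sExchange ends s (sExchange ends s xyz) = xyz := by
  obtain ⟨x, y, z⟩ := xyz
  have hU : cluster ends (sExchange ends s (x, y, z)).1 s ∪
      cluster ends (sExchange ends s (x, y, z)).2.1 s = cluster ends x s ∪ cluster ends y s := by
    rw [cluster_sExchange_fst, cluster_sExchange_snd, Set.union_comm]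
  show (mix ends _ _ _, mix ends _ _ _, z) = (x, y, z)
  rw [hU]
  simp only [sExchange, mix_mix]

/-- The s-exchange preserves the order statistics `(lo, med, hi)` of the triple: on every edge it
either swaps the first two entries or leaves all three alone — so it maps every three-copy fibre
(pattern class of `MM0Pinned.patternCoeff3`) to itself. -/
theorem orderStats_sExchange (xyz : Config E × Config E × Config E) :
    lo (sExchange ends s xyz).1 (sExchange ends s xyz).2.1 (sExchange ends s xyz).2.2 =
        lo xyz.1 xyz.2.1 xyz.2.2 ∧
      med (sExchange ends s xyz).1 (sExchange ends s xyz).2.1 (sExchange ends s xyz).2.2 =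
        med xyz.1 xyz.2.1 xyz.2.2 ∧
      (sExchange ends s xyz).1 ⊔ (sExchange ends s xyz).2.1 ⊔ (sExchange ends s xyz).2.2 =
        xyz.1 ⊔ xyz.2.1 ⊔ xyz.2.2 := by
  obtain ⟨x, y, z⟩ := xyz
  have key : ∀ e, (lo (sExchange ends s (x, y, z)).1 (sExchange ends s (x, y, z)).2.1 z e =
        lo x y z e) ∧
      (med (sExchange ends s (x, y, z)).1 (sExchange ends s (x, y, z)).2.1 z e = med x y z e) ∧
      ((sExchange ends s (x, y, z)).1 ⊔ (sExchange ends s (x, y, z)).2.1 ⊔ z) e = (x ⊔ y ⊔ z) e := by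
    intro e
    simp only [sExchange, lo_eq, med, Pi.inf_apply, Pi.sup_apply]
    by_cases h : e ∈ touches ends (cluster ends x s ∪ cluster ends y s)
    · simp only [mix_apply_of_mem h]
      cases x e <;> cases y e <;> cases z e <;> exact ⟨rfl, rfl, rfl⟩
    · simp only [mix_apply_of_notMem h]
      trivial
  exact ⟨funext fun e => (key e).1, funext fun e => (key e).2.1, funext fun e => (key e).2.2⟩

/-- The connection events of the root are exchanged: `x' ↔ s‑b` iff `y ↔ s‑b`. -/
theorem conn_sExchange_fst_iff (xyz : Config E × Config E × Config E) (b : V) :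
    Conn ends (sExchange ends s xyz).1 s b ↔ Conn ends xyz.2.1 s b := by
  rw [← mem_cluster, ← mem_cluster, cluster_sExchange_fst]

/-- `y' ↔ s‑b` iff `x ↔ s‑b`. -/
theorem conn_sExchange_snd_iff (xyz : Config E × Config E × Config E) (b : V) :
    Conn ends (sExchange ends s xyz).2.1 s b ↔ Conn ends xyz.1 s b := by
  rw [← mem_cluster, ← mem_cluster, cluster_sExchange_snd]

end SExchange

end MM0Pinned
end Summit.Ventures.PercRepro2
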